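import Summits.MatrixMultiplication.OmegaCensus.SmallFormats.MatMul228GF3K4Structure
import Summits.MatrixMultiplication.OmegaCensus.SmallFormats.MatMul22nPairingZeros
import HarnessLib

/-!
# ω-census family (a): NON-ZERO entry recipes of the INV-layer matrix `Q` for a rank-one Y-form against a cheap output — the «z-vector» criterion (`𝔽₃`)

Cell `pub-omega` (unit `pub-omega-tensor`, gen 42), topic `Summits/MatrixMultiplication/OmegaCensus` (sub-folder `SmallFormats`). Framing (verbatim): lottery
ticket; floor = certified bounds/negative ranges. HONEST FRAMING: step 2a of the kernel route to «K4 is not an X-marginal» (HOME/pub-omega-tensor-g42/K4-KERNEL-BLUEPRINT.md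
§7): the entry `Q(Y; s, t) = Σ_{p,q} Y q p · (W_s p ⬝ᵥ G_t q)` (`PointPairing.vecW_dot_pointMatrix_vecG`) when the Y-form of `t` is RANK ONE, `G_t q = η q • g`
(the ZKKI singles of `K4Structure.structure_package`, and the non-pair / (2,2) cells of all-ones rows):
* `Q_eq_dot_mulVec`: `Q = η ⬝ᵥ (Y *ᵥ z)` with the z-VECTOR `z p := W_s p ⬝ᵥ g` (any field);
* `nu_dot_z_eq_zero`: if `W_s` is cheap for the row plane `v` (`Σ_i c m i · (ν ᵥ* W_s) i = 0`, the structure package's `hcch`) and `g ∈ span(c v)`, then `ν ⬝ᵥ z = 0`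
  (any field) — hence over `𝔽₃` `z = ε • rep v` (`exists_eq_smul_rep`), and `Q = ε · (η ⬝ᵥ Y *ᵥ rep v)` (`Q_eq_eps_mul`): **`Q ≠ 0 ⟺ z ≠ 0 ∧ η ⬝ᵥ (Y *ᵥ rep v) ≠ 0`**
  (`Q_ne_zero_iff`) — the second factor is a decidable fact about `(Y, η, v)`;
* `z ≠ 0` certificates: `exists_b_dot_ne_zero` (the kill vector `g = Σ rep r m • c m` is NOT orthogonal to the column plane `span(b)` when `r` is not the null
  representative of the block `(c l ⬝ᵥ b m)`), `z_ne_zero_of_det` (output coefficient matrix invertible: pair cells, `InvertibleAtPairs`), `kcov_dot_ne_zero`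
  (rank-one outputs `W_s p = ω p • Σ rep a l • b l`: non-zero iff additionally `a` is not the column-side null representative), `z_ne_zero_of_rankOne`.
Zero entries need no new lemma (`PairingZeros.Q_eq_zero_of_G_line / _of_W_line`, or a zero block). Nothing here is a bound on `ω`; K4 is not excluded by this file.
-/

namespace Summit.MatrixMultiplication.OmegaCensus.SmallFormats

open Finset Matrix

namespace ZKEntries

variable {k : Type*} [Field k] {n : ℕ}

/-- **The z-vector form of an entry.** If `G q = η q • g` then `Σ_{p,q} Y q p (W p ⬝ᵥ G q) = η ⬝ᵥ (Y *ᵥ z)` with `z p = W p ⬝ᵥ g`. -/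
theorem Q_eq_dot_mulVec (Y : Matrix (Fin 2) (Fin 2) k) (W G : Matrix (Fin 2) (Fin n) k) (η : Fin 2 → k) (g : Fin n → k)
    (hG : ∀ q, G q = η q • g) :
    (∑ p, ∑ q, Y q p * (W p ⬝ᵥ G q)) = η ⬝ᵥ (Y *ᵥ fun p => W p ⬝ᵥ g) := by
  calc (∑ p, ∑ q, Y q p * (W p ⬝ᵥ G q)) = ∑ p, ∑ q, Y q p * (η q * (W p ⬝ᵥ g)) := by
        simp only [hG, dotProduct_smul, smul_eq_mul]
    _ = ∑ q, η q * ∑ p, Y q p * (W p ⬝ᵥ g) := by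
        rw [Finset.sum_comm]
        refine Finset.sum_congr rfl fun q _ => ?_
        rw [Finset.mul_sum]
        exact Finset.sum_congr rfl fun p _ => by ring
    _ = η ⬝ᵥ (Y *ᵥ fun p => W p ⬝ᵥ g) := rfl

/-- **Cheapness makes the z-vector orthogonal to `ν`.** If `Σ_i c m i · (ν ᵥ* W) i = 0` for both `m` and `g = Σ_m x m • c m`, then `ν ⬝ᵥ z = 0`. -/
theorem nu_dot_z_eq_zero (W : Matrix (Fin 2) (Fin n) k) (c : Fin 2 → (Fin n → k)) (ν : Fin 2 → k)
    (hcheap : ∀ m, ∑ i, c m i * (Matrix.vecMul ν W) i = 0) (x : Fin 2 → k) :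
    ν ⬝ᵥ (fun p => W p ⬝ᵥ ∑ m, x m • c m) = 0 := by
  have h1 : ν ⬝ᵥ (fun p => W p ⬝ᵥ ∑ m, x m • c m) = (Matrix.vecMul ν W) ⬝ᵥ ∑ m, x m • c m := by
    rw [← Matrix.dotProduct_mulVec]; rfl
  rw [h1, dotProduct_sum]
  refine Finset.sum_eq_zero fun m _ => ?_
  rw [dotProduct_smul]
  have h2 : Matrix.vecMul ν W ⬝ᵥ c m = ∑ i, c m i * Matrix.vecMul ν W i := by
    rw [dotProduct_comm]; rfl
  rw [h2, hcheap m, smul_zero]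

/-- Over `𝔽₃`: a vector orthogonal to `ν_v = (−rep v 1, rep v 0)` is a multiple of `rep v`. -/
theorem exists_eq_smul_rep (v : Fin 4) (z : Fin 2 → ZMod 3)
    (hz : (![-((![![1, 0], ![0, 1], ![1, 1], ![1, 2]] : Fin 4 → Fin 2 → ZMod 3) v 1), (![![1, 0], ![0, 1], ![1, 1], ![1, 2]] : Fin 4 → Fin 2 → ZMod 3) v 0] : Fin 2 → ZMod 3) ⬝ᵥ z = 0) :
    ∃ ε : ZMod 3, z = ε • (![![1, 0], ![0, 1], ![1, 1], ![1, 2]] : Fin 4 → Fin 2 → ZMod 3) v := by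
  revert v z
  decide

/-- **`Q = ε · (η ⬝ᵥ Y *ᵥ rep v)`** for a rank-one Y-form of row `v` against an output cheap for row `v`. -/
theorem Q_eq_eps_mul (Y : Matrix (Fin 2) (Fin 2) (ZMod 3)) (W G : Matrix (Fin 2) (Fin n) (ZMod 3)) (η : Fin 2 → ZMod 3) (c : Fin 2 → (Fin n → ZMod 3))
    (x : Fin 2 → ZMod 3) (hG : ∀ q, G q = η q • ∑ m, x m • c m) (v : Fin 4)
    (hcheap : ∀ m, ∑ i, c m i * (Matrix.vecMul (![-((![![1, 0], ![0, 1], ![1, 1], ![1, 2]] : Fin 4 → Fin 2 → ZMod 3) v 1), (![![1, 0], ![0, 1], ![1, 1], ![1, 2]] : Fin 4 → Fin 2 → ZMod 3) v 0] : Fin 2 → ZMod 3) W) i = 0) :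
    ∃ ε : ZMod 3, (fun p => W p ⬝ᵥ ∑ m, x m • c m) = ε • (![![1, 0], ![0, 1], ![1, 1], ![1, 2]] : Fin 4 → Fin 2 → ZMod 3) v ∧
      (∑ p, ∑ q, Y q p * (W p ⬝ᵥ G q)) = ε * (η ⬝ᵥ (Y *ᵥ (![![1, 0], ![0, 1], ![1, 1], ![1, 2]] : Fin 4 → Fin 2 → ZMod 3) v)) := by
  obtain ⟨ε, hε⟩ := exists_eq_smul_rep v _ (nu_dot_z_eq_zero W c _ hcheap x)
  refine ⟨ε, hε, ?_⟩
  rw [Q_eq_dot_mulVec Y W G η _ hG, hε, Matrix.mulVec_smul, dotProduct_smul, smul_eq_mul]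

/-- **Non-zero criterion.** With the data of `Q_eq_eps_mul`: `Q ≠ 0 ⟺ z ≠ 0 ∧ η ⬝ᵥ (Y *ᵥ rep v) ≠ 0` (`z p = W p ⬝ᵥ g`). -/
theorem Q_ne_zero_iff (Y : Matrix (Fin 2) (Fin 2) (ZMod 3)) (W G : Matrix (Fin 2) (Fin n) (ZMod 3)) (η : Fin 2 → ZMod 3) (c : Fin 2 → (Fin n → ZMod 3))
    (x : Fin 2 → ZMod 3) (hG : ∀ q, G q = η q • ∑ m, x m • c m) (v : Fin 4)
    (hcheap : ∀ m, ∑ i, c m i * (Matrix.vecMul (![-((![![1, 0], ![0, 1], ![1, 1], ![1, 2]] : Fin 4 → Fin 2 → ZMod 3) v 1), (![![1, 0], ![0, 1], ![1, 1], ![1, 2]] : Fin 4 → Fin 2 → ZMod 3) v 0] : Fin 2 → ZMod 3) W) i = 0) :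
    (∑ p, ∑ q, Y q p * (W p ⬝ᵥ G q)) ≠ 0 ↔
      ((fun p => W p ⬝ᵥ ∑ m, x m • c m) ≠ 0 ∧ η ⬝ᵥ (Y *ᵥ (![![1, 0], ![0, 1], ![1, 1], ![1, 2]] : Fin 4 → Fin 2 → ZMod 3) v) ≠ 0) := by
  obtain ⟨ε, hz, hQ⟩ := Q_eq_eps_mul Y W G η c x hG v hcheap
  have hrep : (![![1, 0], ![0, 1], ![1, 1], ![1, 2]] : Fin 4 → Fin 2 → ZMod 3) v ≠ 0 := by
    have h : ∀ j : Fin 4, (![![1, 0], ![0, 1], ![1, 1], ![1, 2]] : Fin 4 → Fin 2 → ZMod 3) j ≠ 0 := by decide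
    exact h v
  rw [hQ, hz]
  constructor
  · intro h
    refine ⟨fun h0 => ?_, right_ne_zero_of_mul h⟩
    have hε : ε = 0 := by
      by_contra hne
      exact hrep (by simpa [hne] using (smul_eq_zero.mp h0))
    exact h (by rw [hε, zero_mul])
  · rintro ⟨hz0, hY⟩
    refine mul_ne_zero (fun hε => hz0 ?_) hY
    rw [hε, zero_smul]

/-- **The kill vector sees the column plane** (`𝔽₃`): if `r` is not the null representative `r₀` of the block `(c l ⬝ᵥ b m)` (maximality of the null line given),
then `g = Σ rep r m • c m` is not orthogonal to `span(b)`: `∃ l, b l ⬝ᵥ g ≠ 0`. -/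
theorem exists_b_dot_ne_zero (c b : Fin 2 → (Fin n → ZMod 3)) (r r₀ : Fin 4) (hr : r ≠ r₀)
    (hmax : ∀ x : Fin 2 → ZMod 3, (∀ m, (∑ l, x l • c l) ⬝ᵥ b m = 0) →
      (x 0 * (![![1, 0], ![0, 1], ![1, 1], ![1, 2]] : Fin 4 → Fin 2 → ZMod 3) r₀ 1 - x 1 * (![![1, 0], ![0, 1], ![1, 1], ![1, 2]] : Fin 4 → Fin 2 → ZMod 3) r₀ 0) = 0) :
    ∃ l, b l ⬝ᵥ (∑ m, (![![1, 0], ![0, 1], ![1, 1], ![1, 2]] : Fin 4 → Fin 2 → ZMod 3) r m • c m) ≠ 0 := by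
  by_contra hno
  push Not at hno
  have h := hmax ((![![1, 0], ![0, 1], ![1, 1], ![1, 2]] : Fin 4 → Fin 2 → ZMod 3) r) fun m => by rw [dotProduct_comm]; exact hno m
  have key : ∀ r r₀ : Fin 4, ((![![1, 0], ![0, 1], ![1, 1], ![1, 2]] : Fin 4 → Fin 2 → ZMod 3) r 0 * (![![1, 0], ![0, 1], ![1, 1], ![1, 2]] : Fin 4 → Fin 2 → ZMod 3) r₀ 1 -
      (![![1, 0], ![0, 1], ![1, 1], ![1, 2]] : Fin 4 → Fin 2 → ZMod 3) r 1 * (![![1, 0], ![0, 1], ![1, 1], ![1, 2]] : Fin 4 → Fin 2 → ZMod 3) r₀ 0) = 0 → r = r₀ := by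
    decide
  exact hr (key r r₀ h)

/-- **z ≠ 0 for an invertible output coefficient matrix** (pair cells): `W p = Σ Ω p l • b l`, `det Ω ≠ 0`, and `∃ l, b l ⬝ᵥ g ≠ 0` ⇒ `∃ p, W p ⬝ᵥ g ≠ 0`. -/
theorem z_ne_zero_of_det (W : Matrix (Fin 2) (Fin n) k) (b : Fin 2 → (Fin n → k)) (Ω : Matrix (Fin 2) (Fin 2) k)
    (hW : ∀ p, W p = ∑ l, Ω p l • b l) (hdet : Ω.det ≠ 0) (g : Fin n → k) (hu : ∃ l, b l ⬝ᵥ g ≠ 0) :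
    (fun p => W p ⬝ᵥ g) ≠ 0 := by
  intro hz
  have hzu : Ω *ᵥ (fun l => b l ⬝ᵥ g) = 0 := by
    funext p
    have hp := congrFun hz p
    simp only [Pi.zero_apply] at hp
    rw [hW p, sum_dotProduct] at hp
    simp only [smul_dotProduct, smul_eq_mul] at hp
    rw [Pi.zero_apply]
    change ∑ l, Ω p l * (b l ⬝ᵥ g) = 0
    exact hp
  have hu0 : (fun l => b l ⬝ᵥ g) = 0 := Matrix.eq_zero_of_mulVec_eq_zero hdet hzu
  obtain ⟨l, hl⟩ := hu
  exact hl (congrFun hu0 l)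

/-- **z ≠ 0 for a rank-one output** `W p = ω p • kcov` with `ω ≠ 0` and `kcov ⬝ᵥ g ≠ 0`. -/
theorem z_ne_zero_of_rankOne (W : Matrix (Fin 2) (Fin n) k) (ω : Fin 2 → k) (kcov : Fin n → k) (hW : ∀ p, W p = ω p • kcov) (hω : ω ≠ 0)
    (g : Fin n → k) (hk : kcov ⬝ᵥ g ≠ 0) : (fun p => W p ⬝ᵥ g) ≠ 0 := by
  intro hz
  apply hω
  funext p
  have := congrFun hz p
  simp only [Pi.zero_apply, hW p, smul_dotProduct, smul_eq_mul] at this ⊢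
  exact (mul_eq_zero.mp this).resolve_right hk

/-- **The kill covector against the kill vector** (`𝔽₃`, rank-one block): for the block `P = (c l ⬝ᵥ b m)` with row-side null representative `r₀` (maximality) and
column-side null representative `a₀` (`P *ᵥ rep a₀ = 0`), `r ≠ r₀` and `a ≠ a₀` ⇒ `(Σ rep a l • b l) ⬝ᵥ (Σ rep r m • c m) ≠ 0`. -/
theorem kcov_dot_ne_zero (c b : Fin 2 → (Fin n → ZMod 3)) (r r₀ a a₀ : Fin 4) (hr : r ≠ r₀) (ha : a ≠ a₀)
    (hmax : ∀ x : Fin 2 → ZMod 3, (∀ m, (∑ l, x l • c l) ⬝ᵥ b m = 0) →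
      (x 0 * (![![1, 0], ![0, 1], ![1, 1], ![1, 2]] : Fin 4 → Fin 2 → ZMod 3) r₀ 1 - x 1 * (![![1, 0], ![0, 1], ![1, 1], ![1, 2]] : Fin 4 → Fin 2 → ZMod 3) r₀ 0) = 0)
    (ha₀ : ∀ l, (∑ m, (![![1, 0], ![0, 1], ![1, 1], ![1, 2]] : Fin 4 → Fin 2 → ZMod 3) a₀ m • b m) ⬝ᵥ c l = 0) :
    (∑ l, (![![1, 0], ![0, 1], ![1, 1], ![1, 2]] : Fin 4 → Fin 2 → ZMod 3) a l • b l) ⬝ᵥ (∑ m, (![![1, 0], ![0, 1], ![1, 1], ![1, 2]] : Fin 4 → Fin 2 → ZMod 3) r m • c m) ≠ 0 := by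
  set rep : Fin 4 → Fin 2 → ZMod 3 := (![![1, 0], ![0, 1], ![1, 1], ![1, 2]] : Fin 4 → Fin 2 → ZMod 3) with hrep
  set g : Fin n → ZMod 3 := ∑ m, rep r m • c m with hg
  -- the covector `u l := b l ⬝ᵥ g` is non-zero and orthogonal to `rep a₀`
  have hu : ∃ l, b l ⬝ᵥ g ≠ 0 := exists_b_dot_ne_zero c b r r₀ hr hmax
  have hua₀ : ∑ l, rep a₀ l * (b l ⬝ᵥ g) = 0 := by
    have : (∑ l, rep a₀ l • b l) ⬝ᵥ g = 0 := by
      rw [hg, dotProduct_sum]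
      exact Finset.sum_eq_zero fun m _ => by rw [dotProduct_smul, ha₀ m, smul_zero]
    rw [sum_dotProduct] at this
    simpa only [smul_dotProduct, smul_eq_mul] using this
  intro h0
  have hua : ∑ l, rep a l * (b l ⬝ᵥ g) = 0 := by
    rw [sum_dotProduct] at h0
    simpa only [smul_dotProduct, smul_eq_mul] using h0
  -- two vectors of `𝔽₃²` orthogonal to the same non-zero covector are parallel
  have hrep_ne : ∀ j : Fin 4, rep j 0 ≠ 0 ∨ rep j 1 ≠ 0 := by rw [hrep]; decide
  have hαβ : (b 0 ⬝ᵥ g) ≠ 0 ∨ (b 1 ⬝ᵥ g) ≠ 0 := by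
    obtain ⟨l, hl⟩ := hu
    fin_cases l
    · exact Or.inl hl
    · exact Or.inr hl
  rw [Fin.sum_univ_two] at hua hua₀
  obtain ⟨η, h1, h2⟩ := RankOneShapes.prop_of_perp₂ (b 0 ⬝ᵥ g) (b 1 ⬝ᵥ g) (rep a 0) (rep a 1) (rep a₀ 0) (rep a₀ 1) hαβ hua hua₀ (hrep_ne a₀)
  have key : ∀ (a a₀ : Fin 4) (η : ZMod 3), (![![1, 0], ![0, 1], ![1, 1], ![1, 2]] : Fin 4 → Fin 2 → ZMod 3) a 0 = η * (![![1, 0], ![0, 1], ![1, 1], ![1, 2]] : Fin 4 → Fin 2 → ZMod 3) a₀ 0 →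
      (![![1, 0], ![0, 1], ![1, 1], ![1, 2]] : Fin 4 → Fin 2 → ZMod 3) a 1 = η * (![![1, 0], ![0, 1], ![1, 1], ![1, 2]] : Fin 4 → Fin 2 → ZMod 3) a₀ 1 → a = a₀ := by
    decide
  exact ha (key a a₀ η (by rw [hrep] at h1; exact h1) (by rw [hrep] at h2; exact h2))

end ZKEntries

end Summit.MatrixMultiplication.OmegaCensus.SmallFormats
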